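/-
Origin: expansion seat `planner-pub-hodgecm-mc-axioms-1-g14-0`, handover #W62 2026-08-20T15:53:55Z md5 7f2f7e3c18b8 (PKG 418d975d7573 → 7f2f7e3c18b8; 786 l.; MECHANICAL (iib-R) rewrite v3.1 of the PKG file as it stands (34 token edits; rules R1x1+RX[h₂']x33)) (`HOME/mc/pub-hodgecm-mc-axioms-1-g14/revendor/kit-r55/stage55/HodgeCM/Model/ArchKTypeOfSlot.lean`, md5 7f2f7e3c18b8, 786 lines);
landed by the gen-22 packager (p-g22) in gate run 55 REPLACES the earlier landed copy of `HodgeCM/Model/ArchKTypeOfSlot.lean` (seat copy carried the packager Origin header of an earlier run (stripped)).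
-/
/-
Copyright (c) 2026. Released under Apache 2.0 license as described in the file LICENSE.
Cell pub-hodgecm, MODEL layer (construction prover mc-carch-1, gen 2), BINDER-OWNERS rows 12/14/15 (`C` / `hpd` / `hk`):
the honest-pin term in the LITERAL junction slot `U(2,1) × U(1,0)` — binder-2's four-fold relabelled block frame `…At` at `v₁`
with the `W`-blocks of a POSITIVE line relabelled to `(Unit, Empty)` — where the local harmonic family IS the tree's `degOneP` and
the three local inputs (Φ) `μ₀`-type, `hf` harmonicity, `hslot` small datum are DISCHARGED by tree theorems.
-/
import Summits.HodgeConjecture.HodgeCM.Model.ArchKTypeOfLine_2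
import Summits.HodgeConjecture.HodgeCM.Model.HypCensus.SmoothTheta

/-!
# Row 12 in the literal slot: `blockFamilyOfAt … degOnePDual Φ₂`, `harm`/rows 14/15 with the local inputs discharged

#CA4v3/#CA8/#CA9/#CA11/#CA12 are written over discharge-3's block frame `cmBlockRep/cmBlockSection eP eQ` whose `W`-block types are the
raw subtypes `R = PosIdx (x_W(v₁))`, `S = NegIdx (x_W(v₁))`; there the local family `Φ₁` and its three properties ((Φ) `hΦ₁`, `hf`,
`hslot`) are INPUTS.  binder-2's `…At` frame (`HypCensus/ArchDatumBlockAt`, `SmoothTheta.cmBlockFrameAt`, `TorusBlock`) relabels all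
four blocks; for a line POSITIVE at `v₁` — the sign the scalar identity (χ) forces (#CA11) — the relabelling data
`eR : PosIdx (x_W(v₁)) ≃ Unit`, `eS : NegIdx (x_W(v₁)) ≃ Empty` put the slot at the tree's literal currency `DPIdx (Fin 2) Unit Unit Empty`,
where `degOneP`, `unitaryOpPi_dualPairι_degOneP_fst`, `hypOpGen_add_I_smul_rotBoostGen_degOne` and theta-1's `linWeil` datum live.

* § 1 bridge: `cmBlockTransport = cmBlockFrameAt v₁ eP eQ refl refl` (`rfl`); `cmBlockSectionAt v₁ eP eQ eR eS (x, 1) = cmBlockSection eP eQ (x, 1)`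
  (the `W`-component is `1` either way); hence the frame matching for the `…At` section from #CA8 (`cmBlockSectionAt_twist`,
  `cmBlockSectionAt_u21FrameEquiv`) and `hωA` for `lineOmega_k` along it (`lineOmega_k_twistU21_expP_At`); and the BRANCH LEMMA
  `hsec_of_embedding_eq(')`: in the branch `(mk ι₁).embedding = ι₁` the frame-matching hypothesis `hsec` of #CA11–#CA13 holds as typed.
* § 2 `blockFamilyOfAt … eP eQ eR eS Φ₁ Φ₂ : ℓ ↦ F⁻¹ (Φ₁ ℓ ⊠ Φ₂)` (`F := cmBlockFrameAt`), `cmArchWeilRep_cmBlockFrameAt_symm`.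
* § 3 the `K_∞`-action / (W-K∞′) engine of #CA11 in the `…At` frame: `smulPull_blockFamilyOfAt_stabilizer`, `smulPull_blockFamilyOfAt_harm`
  — (K) is binder-2's `exists_vacExponents_cmBlockRepAt_κ_tensorPi` conclusion VERBATIM.
* § 4 the literal family `degOnePDual S' := degOneP ∘ ⟨·,·⟩⁻¹ : (ℂ²)^∨ →ₗ 𝓢(ℝ^{DPIdx (Fin 2) Unit Unit S'})` with (Φ) `unitaryOpPi_dualPairι_degOnePDual`
  and `hf` `hypOpGen_add_I_smul_rotBoostGen_degOnePDual [IsEmpty S']` PROVED (tree, [Folland 1989, Prop. (4.39)]).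
* § 5 lines 0/1 of the honest S term in the literal slot: **`archKTypeOfSlotZero/One (eR) (eS) …`** with `Φarch := blockFamilyOfAt … eR eS
  (degOnePDual Empty) Φ₂`; remaining hypotheses {`hlevel`, `arch₀`, `harch`, `hfin`, `hsec` (route (a)), `ev`/`hK` (binder-2, ∃-discharged),
  `hχ`} — (Φ) GONE; **row 14 `isWeaklyPDiff_archKTypeOfSlotZero/One` with NO further hypothesis** (slot datum = theta-1's at `(Unit, Empty)`,
  sign facts discharged, BRICK 4 generic `ArchKTypeData.isWeaklyPDiff_of_blockPair` over binder-2's `…At` data, #CA10 to `expP`);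
  **row 15 `isPMinusKilledAlong_archKTypeOfSlotZero/One_twist` along `twistU21 ∘ expP` with NO further hypothesis** (`hf` = § 4) — its
  `expP` form is exactly the (TWIST-2) item; `archKTypeOfSlot k hk` the `k`-dispatch and its row 14.

Nothing is cited and nothing is minted: one linear family (explicit formula), one block family, kernel lemmas; 0 records, 0 `def … : Prop`.
-/

set_option autoImplicit false

noncomputable section

open Filter Topology Complex
open NumberField NumberField.InfinitePlace NumberField.mixedEmbedding IsDedekindDomain MeasureTheory
open scoped Matrix TensorProduct Classical SchwartzMap
open MulAction
open Literature.Geometry.ComplexHyperbolic.BallModel (U21 x₀ stabilizerEquivK21)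
open Literature.NumberTheory.Automorphic.U21 (K21 matA sclD pPlus pPlus_apply)
open Literature.AlgebraicGeometry.HodgeTheory
open Literature.AlgebraicGeometry.ShimuraVarieties Literature.AlgebraicGeometry.ShimuraVarieties.BallForms
open Literature.NumberTheory.Automorphic Literature.NumberTheory.Weil1964
open Literature.RepresentationTheory.HeisenbergGroup (polar Heisenberg symplecticGroup ofSymplectic)
open Literature.RepresentationTheory.KonnoKonno2007 Literature.RepresentationTheory.KonnoKonno2007.RealDualPair
open Literature.NumberTheory.GelbartRogawski1991 Literature.NumberTheory.GelbartRogawski1991.UnitaryDualPair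
open Literature.Analysis.SegalBargmann Literature.Analysis.Distribution
open Literature.NumberTheory.Automorphic.PicardCM
open HodgeCM.Adelic HodgeCM.PerL34 HodgeCM.Model.HypCensus HodgeCM.Model.SupplyInstance HodgeCM.Model.ArchSideTerm

namespace HodgeCM.Model

/-! ## § 1 The bridge between the `V`-relabelled and the four-fold relabelled block frames at `v₁` -/

section Bridge

variable (L : Type) [Field L] [NumberField L] [IsCMField L] {N M n : ℕ} (e : Fin N × Fin M ≃ Fin n)
variable (dV : Fin N → L) (hdV : ∀ i, IsCMField.complexConj L (dV i) = dV i) (hdV0 : ∀ i, dV i ≠ 0)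
variable (dW : Fin M → L) (hdW : ∀ i, IsCMField.complexConj L (dW i) = dW i) (hdW0 : ∀ i, dW i ≠ 0)
variable (hGR : (cmSplittingDatum L e dV hdV hdV0 dW hdW hdW0).CompatibleSplitting) (ι₁ : L →+* ℂ)
variable (eP : PosIdx (cmXV L dV hdV ι₁ (cmPlace L ι₁)) ≃ Fin 2) (eQ : NegIdx (cmXV L dV hdV ι₁ (cmPlace L ι₁)) ≃ Unit)
variable {R' S' : Type} [Fintype R'] [DecidableEq R'] [Fintype S'] [DecidableEq S']
  (eR : PosIdx (cmXW L dV dW hdW ι₁ (cmPlace L ι₁)) ≃ R') (eS : NegIdx (cmXW L dV dW hdW ι₁ (cmPlace L ι₁)) ≃ S')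

/-- #CA4's block transport IS binder-2's `cmBlockFrameAt` at `v₁` with `eR = eS = refl` (same composite). -/
theorem cmBlockTransport_eq_cmBlockFrameAt :
    cmBlockTransport L e dV hdV hdV0 dW hdW hdW0 ι₁ eP eQ =
      cmBlockFrameAt L e dV hdV hdV0 dW hdW hdW0 ι₁ (cmPlace L ι₁) eP eQ (Equiv.refl _) (Equiv.refl _) :=
  rfl

/-- the inverse four-fold relabelling on an element with trivial `W`-component. -/
theorem relabel_symm_inl_one (x : UForm (Fin 2) Unit) :
    ((Ginf.relabel (PosIdx (cmXV L dV hdV ι₁ (cmPlace L ι₁))) (NegIdx (cmXV L dV hdV ι₁ (cmPlace L ι₁)))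
        (PosIdx (cmXW L dV dW hdW ι₁ (cmPlace L ι₁))) (NegIdx (cmXW L dV dW hdW ι₁ (cmPlace L ι₁))) (Fin 2) Unit R' S'
        eP eQ eR eS).symm.toMulEquiv.toMonoidHom : Ginf (Fin 2) Unit R' S' →* _) (x, 1) =
      ((UForm.relabel _ _ (Fin 2) Unit eP eQ).symm x, 1) := by
  change (Ginf.relabel _ _ _ _ (Fin 2) Unit R' S' eP eQ eR eS).symm (x, 1) = _
  apply (Ginf.relabel _ _ _ _ (Fin 2) Unit R' S' eP eQ eR eS).injective
  rw [ContinuousMulEquiv.apply_symm_apply, Ginf.relabel_apply, Prod.mk.injEq]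
  exact ⟨((UForm.relabel _ _ (Fin 2) Unit eP eQ).apply_symm_apply x).symm, (map_one _).symm⟩

/-- **bridge**: on elements with trivial `W`-component binder-2's four-fold relabelled section agrees with discharge-3's. -/
theorem cmBlockSectionAt_inl_one (x : UForm (Fin 2) Unit) :
    cmBlockSectionAt L dV hdV hdV0 dW hdW hdW0 ι₁ (cmPlace L ι₁) eP eQ eR eS (x, 1) =
      cmBlockSection L dV hdV hdV0 dW hdW hdW0 ι₁ eP eQ (x, 1) := by
  unfold cmBlockSectionAt cmBlockSection
  rw [MonoidHom.comp_apply, MonoidHom.comp_apply, relabel_symm_inl_one, relabel_symm_inl_one]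

omit [DecidableEq R'] [DecidableEq S'] in
/-- `cmArchWeilRep g (F⁻¹ x) = F⁻¹ (cmBlockRepAt g x)` for `F := cmBlockFrameAt` (intertwining identity `hτ` needs). -/
theorem cmArchWeilRep_cmBlockFrameAt_symm (v : {v : InfinitePlace ↥(maximalRealSubfield L) // v.IsReal})
    {P' Q' : Type} [Fintype P'] [DecidableEq P'] [Fintype Q'] [DecidableEq Q']
    (eP' : PosIdx (cmXV L dV hdV ι₁ v) ≃ P') (eQ' : NegIdx (cmXV L dV hdV ι₁ v) ≃ Q')
    (eR' : PosIdx (cmXW L dV dW hdW ι₁ v) ≃ R') (eS' : NegIdx (cmXW L dV dW hdW ι₁ v) ≃ S')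
    (g : UnitaryGroup.arch (↥(maximalRealSubfield L)) L (IsCMField.complexConj L) N (Matrix.diagonal dV) ×
      UnitaryGroup.arch (↥(maximalRealSubfield L)) L (IsCMField.complexConj L) M (Matrix.diagonal dW))
    (x : SchwartzMap (DPIdx P' Q' R' S' ⊕
      (Fin n × {w : {w : InfinitePlace ↥(maximalRealSubfield L) // w.IsReal} // w ≠ v}) → ℝ) ℂ) :
    cmArchWeilRep L e dV hdV hdV0 dW hdW hdW0 hGR g ((cmBlockFrameAt L e dV hdV hdV0 dW hdW hdW0 ι₁ v eP' eQ' eR' eS').symm x) =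
      (cmBlockFrameAt L e dV hdV hdV0 dW hdW hdW0 ι₁ v eP' eQ' eR' eS').symm
        (cmBlockRepAt L e dV hdV hdV0 dW hdW hdW0 hGR ι₁ v eP' eQ' eR' eS' g x) := by
  rw [cmBlockRepAt_apply_eq, ContinuousLinearEquiv.symm_apply_apply]

/-! ## § 2 The harmonic family through the four-fold relabelled frame -/

omit [DecidableEq R'] [DecidableEq S'] in
/-- **`blockFamilyOfAt … Φ₁ Φ₂ : ℓ ↦ F⁻¹ (Φ₁ ℓ ⊠ Φ₂)`**, `F := cmBlockFrameAt v₁ eP eQ eR eS`. -/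
def blockFamilyOfAt
    (Φ₁ : Module.Dual ℂ (Fin 2 → ℂ) →ₗ[ℂ] SchwartzMap (DPIdx (Fin 2) Unit R' S' → ℝ) ℂ)
    (Φ₂ : SchwartzMap ((Fin n × {v : {v : InfinitePlace ↥(maximalRealSubfield L) // v.IsReal} // v ≠ cmPlace L ι₁}) → ℝ) ℂ) :
    Module.Dual ℂ (Fin 2 → ℂ) →ₗ[ℂ] 𝓢((Fin n → mixedSpace (↥(maximalRealSubfield L))), ℂ) where
  toFun ℓ := (cmBlockFrameAt L e dV hdV hdV0 dW hdW hdW0 ι₁ (cmPlace L ι₁) eP eQ eR eS).symm (SchwartzMap.sumProdLeftCLM Φ₂ (Φ₁ ℓ))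
  map_add' ℓ ℓ' := by simp only [map_add]
  map_smul' a ℓ := by simp only [map_smul, RingHom.id_apply]

omit [DecidableEq R'] [DecidableEq S'] in
/-- (Ported verbatim from the HodgeCMPerL package; no docstring in the source.) -/
@[simp] theorem blockFamilyOfAt_apply
    (Φ₁ : Module.Dual ℂ (Fin 2 → ℂ) →ₗ[ℂ] SchwartzMap (DPIdx (Fin 2) Unit R' S' → ℝ) ℂ)
    (Φ₂ : SchwartzMap ((Fin n × {v : {v : InfinitePlace ↥(maximalRealSubfield L) // v.IsReal} // v ≠ cmPlace L ι₁}) → ℝ) ℂ)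
    (ℓ : Module.Dual ℂ (Fin 2 → ℂ)) :
    blockFamilyOfAt L e dV hdV hdV0 dW hdW hdW0 ι₁ eP eQ eR eS Φ₁ Φ₂ ℓ =
      (cmBlockFrameAt L e dV hdV hdV0 dW hdW hdW0 ι₁ (cmPlace L ι₁) eP eQ eR eS).symm (SchwartzMap.sumProdLeftCLM Φ₂ (Φ₁ ℓ)) :=
  rfl

/-- the `eR = eS = refl` case is #CA4's `blockFamilyOf` (`rfl`). -/
theorem blockFamilyOfAt_refl
    (Φ₁ : Module.Dual ℂ (Fin 2 → ℂ) →ₗ[ℂ]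
      SchwartzMap (DPIdx (Fin 2) Unit (PosIdx (cmXW L dV dW hdW ι₁ (cmPlace L ι₁))) (NegIdx (cmXW L dV dW hdW ι₁ (cmPlace L ι₁))) → ℝ) ℂ)
    (Φ₂ : SchwartzMap ((Fin n × {v : {v : InfinitePlace ↥(maximalRealSubfield L) // v.IsReal} // v ≠ cmPlace L ι₁}) → ℝ) ℂ) :
    blockFamilyOfAt L e dV hdV hdV0 dW hdW hdW0 ι₁ eP eQ (Equiv.refl _) (Equiv.refl _) Φ₁ Φ₂ =
      blockFamilyOf L e dV hdV hdV0 dW hdW hdW0 ι₁ eP eQ Φ₁ Φ₂ :=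
  rfl

end Bridge

/-! ### the pin frame: frame matching and `hωA` for the `…At` section -/

section PinBridge

variable {L : CMField} {ι₁ : L →+* ℂ} (V : HermSpace3 L ι₁)
variable {M' : ℕ} (dW : Fin M' → (L : Type)) (hdW : ∀ i, IsCMField.complexConj (L : Type) (dW i) = dW i) (hdW0 : ∀ i, dW i ≠ 0)
variable {R' S' : Type} [Fintype R'] [DecidableEq R'] [Fintype S'] [DecidableEq S']
  (eR : PosIdx (cmXW (L : Type) (frameD V) dW hdW ι₁ (cmPlace (L : Type) ι₁)) ≃ R')
  (eS : NegIdx (cmXW (L : Type) (frameD V) dW hdW ι₁ (cmPlace (L : Type) ι₁)) ≃ S')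

/-- **frame matching for the `…At` section** (#CA8 `cmBlockSection_twist` + bridge). -/
theorem cmBlockSectionAt_twist (u : U21) :
    cmBlockSectionAt (L : Type) (frameD V) (frameD_real V) (frameD_ne V) dW hdW hdW0 ι₁ (cmPlace (L : Type) ι₁) (blockPosEquiv V)
        (blockNegEquiv V) eR eS (u21FrameEquiv (twistU21 L ι₁ u), 1) = (archSectionFrameOf V u, 1) := by
  rw [cmBlockSectionAt_inl_one, cmBlockSection_twist]

/-- … on the untwisted ball frame. -/
theorem cmBlockSectionAt_u21FrameEquiv (u : U21) :
    cmBlockSectionAt (L : Type) (frameD V) (frameD_real V) (frameD_ne V) dW hdW hdW0 ι₁ (cmPlace (L : Type) ι₁) (blockPosEquiv V)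
        (blockNegEquiv V) eR eS (u21FrameEquiv u, 1) = (archSectionFrameOf V (twistU21 L ι₁ u), 1) := by
  rw [cmBlockSectionAt_inl_one, cmBlockSection_u21FrameEquiv]

/-- in the branch `(mk ι₁).embedding = ι₁` of Mathlib's representative the twist is the identity … -/
theorem twistU21_eq_self_of_embedding_eq (h : (InfinitePlace.mk ι₁).embedding = ι₁) (u : U21) : twistU21 L ι₁ u = u := by
  apply Subtype.ext
  apply Units.ext
  ext i j
  exact UnitaryGroup.embTwist_apply_of_eq (L : Type) ι₁ h _

/-- … so there the frame-matching hypothesis `hsec` of #CA11–#CA13 HOLDS AS TYPED (the untwisted form); in the other branch it is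
the (TWIST-2) item (route (a): binder-2 reads the `v₁`-factor through `ι₁`, after which this lemma holds unconditionally). -/
theorem hsec_of_embedding_eq (h : (InfinitePlace.mk ι₁).embedding = ι₁) (u : stabilizer U21 x₀) :
    cmBlockSectionAt (L : Type) (frameD V) (frameD_real V) (frameD_ne V) dW hdW hdW0 ι₁ (cmPlace (L : Type) ι₁) (blockPosEquiv V)
        (blockNegEquiv V) eR eS (u21FrameEquiv (u : U21), 1) = (archSectionFrameOf V u, 1) := by
  rw [cmBlockSectionAt_u21FrameEquiv, twistU21_eq_self_of_embedding_eq h]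

/-- the same for discharge-3's section (the `hsec` of #CA11/#CA12). -/
theorem hsec_of_embedding_eq' (h : (InfinitePlace.mk ι₁).embedding = ι₁) (u : stabilizer U21 x₀) :
    cmBlockSection (L : Type) (frameD V) (frameD_real V) (frameD_ne V) dW hdW hdW0 ι₁ (blockPosEquiv V) (blockNegEquiv V)
        (u21FrameEquiv (u : U21), 1) = (archSectionFrameOf V u, 1) := by
  rw [cmBlockSection_u21FrameEquiv, twistU21_eq_self_of_embedding_eq h]

end PinBridge

/-! ## § 3 The `K_∞`-action and (W-K∞′) in the `…At` frame -/

section HarmAt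

variable {L : CMField} {ι₁ : L →+* ℂ} (V : HermSpace3 L ι₁)
variable {M' : ℕ} (e : Fin 3 × Fin M' ≃ Fin 3)
  (dW : Fin M' → (L : Type)) (hdW : ∀ i, IsCMField.complexConj (L : Type) (dW i) = dW i) (hdW0 : ∀ i, dW i ≠ 0)
  (hGR : (cmSplittingDatum (L : Type) e (frameD V) (frameD_real V) (frameD_ne V) dW hdW hdW0).CompatibleSplitting)
  (χ : U21 →* ℂˣ)
variable {R' S' : Type} [Fintype R'] [DecidableEq R'] [Fintype S'] [DecidableEq S']
  (eR : PosIdx (cmXW (L : Type) (frameD V) dW hdW ι₁ (cmPlace (L : Type) ι₁)) ≃ R')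
  (eS : NegIdx (cmXW (L : Type) (frameD V) dW hdW ι₁ (cmPlace (L : Type) ι₁)) ≃ S')
  (Φ₁ : Module.Dual ℂ (Fin 2 → ℂ) →ₗ[ℂ] SchwartzMap (DPIdx (Fin 2) Unit R' S' → ℝ) ℂ)
  (Φ₂ : SchwartzMap ((Fin 3 × {v : {v : InfinitePlace ↥(maximalRealSubfield L) // v.IsReal} // v ≠ cmPlace (L : Type) ι₁}) → ℝ) ℂ)

/-- **the `K_∞`-action on the harmonic family, `…At` frame** (cf. #CA11 `smulPull_blockFamilyOf_stabilizer`). -/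
theorem smulPull_blockFamilyOfAt_stabilizer
    (hsec : ∀ u : stabilizer U21 x₀,
      cmBlockSectionAt (L : Type) (frameD V) (frameD_real V) (frameD_ne V) dW hdW hdW0 ι₁ (cmPlace (L : Type) ι₁) (blockPosEquiv V)
          (blockNegEquiv V) eR eS (u21FrameEquiv (u : U21), 1) = (archSectionFrameOf V u, 1))
    {ev : VacExponents}
    (hK : ∀ (kk : DPK (Fin 2) Unit R' S') (Φ : SchwartzMap (DPIdx (Fin 2) Unit R' S' → ℝ) ℂ),
      cmBlockRepAt (L : Type) e (frameD V) (frameD_real V) (frameD_ne V) dW hdW hdW0 hGR ι₁ (cmPlace (L : Type) ι₁) (blockPosEquiv V)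
          (blockNegEquiv V) eR eS
          (cmBlockSectionAt (L : Type) (frameD V) (frameD_real V) (frameD_ne V) dW hdW hdW0 ι₁ (cmPlace (L : Type) ι₁)
            (blockPosEquiv V) (blockNegEquiv V) eR eS (κ _ _ _ _ kk)) (tensorPi Φ Φ₂) =
        tensorPi (κOp _ _ ev kk Φ) Φ₂)
    (hΦ₁ : ∀ (kV : Matrix.unitaryGroup (Fin 2) ℂ × Matrix.unitaryGroup Unit ℂ) (b : Fin 2 → ℂ),
      unitaryOpPi (dualPairι ((kV, 1) : DPK (Fin 2) Unit R' S')) (Φ₁ (dotProductEquiv ℂ (Fin 2) b)) =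
        Φ₁ (dotProductEquiv ℂ (Fin 2) ((kV.1 : Matrix (Fin 2) (Fin 2) ℂ) *ᵥ b)))
    (u : stabilizer U21 x₀) (b : Fin 2 → ℂ) :
    Representation.smulPull χ (cmArchWeilRep (L : Type) e (frameD V) (frameD_real V) (frameD_ne V) dW hdW hdW0 hGR)
        (MonoidHom.prod (archSectionFrameOf V) 1) (u : U21)
        (blockFamilyOfAt (L : Type) e (frameD V) (frameD_real V) (frameD_ne V) dW hdW hdW0 ι₁ (blockPosEquiv V) (blockNegEquiv V) eR eS
          Φ₁ Φ₂ (dotProductEquiv ℂ (Fin 2) b)) =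
      (((χ (u : U21) : ℂˣ) : ℂ) *
          vacScalar ev (((((stabilizerEquivK21.symm u).1, unitaryToUnit (stabilizerEquivK21.symm u).2) :
              Matrix.unitaryGroup (Fin 2) ℂ × Matrix.unitaryGroup Unit ℂ), 1) : DPK (Fin 2) Unit R' S')) •
        blockFamilyOfAt (L : Type) e (frameD V) (frameD_real V) (frameD_ne V) dW hdW hdW0 ι₁ (blockPosEquiv V) (blockNegEquiv V) eR eS
          Φ₁ Φ₂ (dotProductEquiv ℂ (Fin 2) (matA (stabilizerEquivK21.symm u) *ᵥ b)) := by
  rw [Representation.smulPull_apply, LinearMap.smul_apply, MonoidHom.prod_apply, MonoidHom.one_apply, ← hsec u,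
    frame_stabilizer_eq_κ', blockFamilyOfAt_apply, blockFamilyOfAt_apply, sumProdLeftCLM_apply_eq_tensorPi,
    sumProdLeftCLM_apply_eq_tensorPi, cmArchWeilRep_cmBlockFrameAt_symm, hK, κOp, _root_.smul_apply, hΦ₁,
    tensorPi_smul_left, map_smul, smul_smul]

/-- **(W-K∞′) in the `…At` frame** (cf. #CA11 `smulPull_blockFamilyOf_harm`). -/
theorem smulPull_blockFamilyOfAt_harm
    (hsec : ∀ u : stabilizer U21 x₀,
      cmBlockSectionAt (L : Type) (frameD V) (frameD_real V) (frameD_ne V) dW hdW hdW0 ι₁ (cmPlace (L : Type) ι₁) (blockPosEquiv V)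
          (blockNegEquiv V) eR eS (u21FrameEquiv (u : U21), 1) = (archSectionFrameOf V u, 1))
    {ev : VacExponents}
    (hK : ∀ (kk : DPK (Fin 2) Unit R' S') (Φ : SchwartzMap (DPIdx (Fin 2) Unit R' S' → ℝ) ℂ),
      cmBlockRepAt (L : Type) e (frameD V) (frameD_real V) (frameD_ne V) dW hdW hdW0 hGR ι₁ (cmPlace (L : Type) ι₁) (blockPosEquiv V)
          (blockNegEquiv V) eR eS
          (cmBlockSectionAt (L : Type) (frameD V) (frameD_real V) (frameD_ne V) dW hdW hdW0 ι₁ (cmPlace (L : Type) ι₁)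
            (blockPosEquiv V) (blockNegEquiv V) eR eS (κ _ _ _ _ kk)) (tensorPi Φ Φ₂) =
        tensorPi (κOp _ _ ev kk Φ) Φ₂)
    (hΦ₁ : ∀ (kV : Matrix.unitaryGroup (Fin 2) ℂ × Matrix.unitaryGroup Unit ℂ) (b : Fin 2 → ℂ),
      unitaryOpPi (dualPairι ((kV, 1) : DPK (Fin 2) Unit R' S')) (Φ₁ (dotProductEquiv ℂ (Fin 2) b)) =
        Φ₁ (dotProductEquiv ℂ (Fin 2) ((kV.1 : Matrix (Fin 2) (Fin 2) ℂ) *ᵥ b)))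
    (hχ : ∀ u : stabilizer U21 x₀,
      ((χ (u : U21) : ℂˣ) : ℂ) * ((matA (stabilizerEquivK21.symm u)).det ^ ev.eP * sclD (stabilizerEquivK21.symm u) ^ ev.eQ) =
        star (sclD (stabilizerEquivK21.symm u)))
    (u : stabilizer U21 x₀) (ℓ : Module.Dual ℂ (Fin 2 → ℂ)) :
    Representation.smulPull χ (cmArchWeilRep (L : Type) e (frameD V) (frameD_real V) (frameD_ne V) dW hdW hdW0 hGR)
        (MonoidHom.prod (archSectionFrameOf V) 1) (u : U21)
        (blockFamilyOfAt (L : Type) e (frameD V) (frameD_real V) (frameD_ne V) dW hdW hdW0 ι₁ (blockPosEquiv V) (blockNegEquiv V) eR eS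
          Φ₁ Φ₂ ℓ) =
      blockFamilyOfAt (L : Type) e (frameD V) (frameD_real V) (frameD_ne V) dW hdW hdW0 ι₁ (blockPosEquiv V) (blockNegEquiv V) eR eS Φ₁ Φ₂
        ((isPullbackCocycle_cotangentCocycle.weightOf x₀).dual u ℓ) := by
  obtain ⟨b, rfl⟩ := (dotProductEquiv ℂ (Fin 2)).surjective ℓ
  rw [smulPull_blockFamilyOfAt_stabilizer V e dW hdW hdW0 hGR χ eR eS Φ₁ Φ₂ hsec hK hΦ₁, vacScalar_stabilizer, hχ u,
    weightOf_cotangent_dual_apply, pPlus_apply, map_smul, map_smul]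

end HarmAt

/-! ## § 4 The literal degree-one family and its two local properties -/

section DegOne

variable (S' : Type) [Fintype S'] [DecidableEq S']

/-- **`degOnePDual S' := degOneP ∘ ⟨·,·⟩⁻¹`**: the holomorphic degree-one family of the literal junction `U(2,1) × U(1, |S'|)`, indexed by
covectors `ℓ = ⟨b,·⟩ ↦ Σ_p b_p h_{e_{(p,⋆)}}`. -/
def degOnePDual : Module.Dual ℂ (Fin 2 → ℂ) →ₗ[ℂ] SchwartzMap (DPIdx (Fin 2) Unit Unit S' → ℝ) ℂ :=
  (degOneP : (Fin 2 → ℂ) →ₗ[ℂ] SchwartzMap (DPIdx (Fin 2) Unit Unit S' → ℝ) ℂ) ∘ₗ (dotProductEquiv ℂ (Fin 2)).symm.toLinearMap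

/-- (Ported verbatim from the HodgeCMPerL package; no docstring in the source.) -/
@[simp] theorem degOnePDual_apply (b : Fin 2 → ℂ) :
    degOnePDual S' (dotProductEquiv ℂ (Fin 2) b) = degOneP b := by
  simp [degOnePDual]

/-- **(Φ) for the literal family**: the standard `μ₀`-type on `U(2) × U(1)`, fixed by `K′`. [Folland 1989, Prop. (4.39)] -/
theorem unitaryOpPi_dualPairι_degOnePDual (kV : Matrix.unitaryGroup (Fin 2) ℂ × Matrix.unitaryGroup Unit ℂ) (b : Fin 2 → ℂ) :
    unitaryOpPi (dualPairι ((kV, 1) : DPK (Fin 2) Unit Unit S')) (degOnePDual S' (dotProductEquiv ℂ (Fin 2) b)) =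
      degOnePDual S' (dotProductEquiv ℂ (Fin 2) ((kV.1 : Matrix (Fin 2) (Fin 2) ℂ) *ᵥ b)) := by
  rw [degOnePDual_apply, degOnePDual_apply, unitaryOpPi_dualPairι_degOneP_fst]

/-- **`hf` for the literal family** at a definite `W`-line (`S' = ∅`): `𝔭⁻` kills every degree-one vector. [Folland 1989, Prop. (4.39)] -/
theorem hypOpGen_add_I_smul_rotBoostGen_degOnePDual [IsEmpty S'] (p : Fin 2) (ℓ : Module.Dual ℂ (Fin 2 → ℂ)) :
    hypOpGen Unit S' p () (degOnePDual S' ℓ) + Complex.I • rotBoostGen Unit S' p () (Real.pi / 2) (degOnePDual S' ℓ) = 0 := by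
  obtain ⟨b, rfl⟩ := (dotProductEquiv ℂ (Fin 2)).surjective ℓ
  rw [degOnePDual_apply, degOneP_apply, degOnePR_apply]
  exact hypOpGen_add_I_smul_rotBoostGen_degOne Unit S' p () _

end DegOne

/-! ## § 5 Lines 0 and 1 of the honest S term in the literal slot `(Unit, Empty)` -/

section Slot

variable (hHD : exists_isReal_hodgeModel) (hI : hodgePQ_independent_of_hodgeModel)
  (h₁ : BallQuotientUniformised)  (h₃ : CMAbelianVarietyRealised)

variable {L : CMField} {ι₁ : L →+* ℂ} (V : HermSpace3 L ι₁) (c : SeesawCtx L)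
  (hGR : (cmSplittingDatum (L : Type) finProdFinEquiv (frameD V) (frameD_real V) (frameD_ne V) (dW c.D) (dW_real c.D)
    (dW_ne c.D)).CompatibleSplitting)
  (hGR₀ : (cmSplittingDatum (L : Type) (e₁) (frameD V) (frameD_real V) (frameD_ne V) (lineVec (L : Type) (dW c.D 0))
    (fun _ => dW_real c.D 0) (fun _ => dW_ne c.D 0)).CompatibleSplitting)
  (hGR₁ : (cmSplittingDatum (L : Type) (e₁) (frameD V) (frameD_real V) (frameD_ne V) (lineVec (L : Type) (dW c.D 1))
    (fun _ => dW_real c.D 1) (fun _ => dW_ne c.D 1)).CompatibleSplitting)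
  (hGR₂ : (cmSplittingDatum (L : Type) (e₁) (frameD V) (frameD_real V) (frameD_ne V) (lineVec (L : Type) (dW' c.D 0))
    (fun _ => dW'_real c.D 0) (fun _ => dW'_ne c.D 0)).CompatibleSplitting)
  (hGR₃ : (cmSplittingDatum (L : Type) (e₁) (frameD V) (frameD_real V) (frameD_ne V) (lineVec (L : Type) (dW' c.D 1))
    (fun _ => dW'_real c.D 1) (fun _ => dW'_ne c.D 1)).CompatibleSplitting)
  (η : CMAdelic (L : Type) (frameD V) × CMAdelic (L : Type) (dW c.D) →* ℂˣ)
  (hη : ∀ γU ∈ CMRat (L : Type) (frameD V), ∀ γ ∈ CMRat (L : Type) (dW c.D), η (γU, γ) = 1)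
  (hηc : Continuous fun p => ((η p : ℂˣ) : ℂ))
  (h₁W : (∀ j, 0 < (ι₁ (dW c.D j)).re) ∨ ∀ j, (ι₁ (dW c.D j)).re < 0)
  (A : ∀ k : Fin 4, ArchLineInput V (lineRepD V c.D hGR hGR₀ hGR₁ hGR₂ hGR₃ η k))
  (hV : IsAnisotropic L V.Hm) (N : ℕ) (Γ₀ : Level V)
  (hlevel : ∀ δ ∈ levelImage hHD hI h₁ h₃ Γ₀ hV, ∃ x : (V.latticeModel printFact_unitaryCompact_holds).G,
    x ∈ (satLevelRegimeOf V hV Γ₀.K : Subgroup (V.latticeModel printFact_unitaryCompact_holds).G) ∧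
      (archSideOf V c hGR hGR₀ hGR₁ hGR₂ hGR₃ η hη hηc h₁W A).ιinf δ * x ∈ (V.latticeModel printFact_unitaryCompact_holds).Γ)
  (Φ₂ : SchwartzMap ((Fin 3 × {v : {v : InfinitePlace ↥(maximalRealSubfield L) // v.IsReal} // v ≠ cmPlace (L : Type) ι₁}) → ℝ) ℂ)

/-! ### line 0 -/

section Zero

variable
  (eR : PosIdx (cmXW (L : Type) (frameD V) (lineVec (L : Type) (dW c.D 0)) (fun _ => dW_real c.D 0) ι₁ (cmPlace (L : Type) ι₁)) ≃ Unit)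
  (eS : NegIdx (cmXW (L : Type) (frameD V) (lineVec (L : Type) (dW c.D 0)) (fun _ => dW_real c.D 0) ι₁ (cmPlace (L : Type) ι₁)) ≃ Empty)
  (ℓ₀ : Module.Dual ℂ (Fin 2 → ℂ))
  (arch₀ : blockFamilyOfAt (L : Type) e₁ (frameD V) (frameD_real V) (frameD_ne V) (lineVec (L : Type) (dW c.D 0))
      (fun _ => dW_real c.D 0) (fun _ => dW_ne c.D 0) ι₁ (blockPosEquiv V) (blockNegEquiv V) eR eS (degOnePDual Empty) Φ₂ ℓ₀ =
    (A 0).Φinf)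
  (harch : ∀ a : UnitaryGroup.arch (↥(maximalRealSubfield L)) L (IsCMField.complexConj L) 3 V.Hm,
    UnitaryGroup.archAt (↥(maximalRealSubfield L)) L (IsCMField.complexConj L) 3 V.Hm (UnitaryGroup.cmPlace (L : Type) ι₁)
        (NumberField.complexConj_smul_infinitePlace (L : Type) _) (IsCMField.complexConj_ne_one (L : Type)) a = 1 →
    ∀ ℓ, ((archSideOf V c hGR hGR₀ hGR₁ hGR₂ hGR₃ η hη hηc h₁W A).P 0).ω
        (HodgeCM.Adelic.regimeEquiv L V.Hm hV
          (UnitaryGroup.archToAdelic (↥(maximalRealSubfield L)) L (IsCMField.complexConj L) 3 V.Hm a), 1)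
        (testFun (↥(maximalRealSubfield L)) (Fin 3)
          (blockFamilyOfAt (L : Type) e₁ (frameD V) (frameD_real V) (frameD_ne V) (lineVec (L : Type) (dW c.D 0))
            (fun _ => dW_real c.D 0) (fun _ => dW_ne c.D 0) ι₁ (blockPosEquiv V) (blockNegEquiv V) eR eS (degOnePDual Empty) Φ₂ ℓ)
          (A 0).x₀ N) =
      testFun (↥(maximalRealSubfield L)) (Fin 3)
        (blockFamilyOfAt (L : Type) e₁ (frameD V) (frameD_real V) (frameD_ne V) (lineVec (L : Type) (dW c.D 0))
          (fun _ => dW_real c.D 0) (fun _ => dW_ne c.D 0) ι₁ (blockPosEquiv V) (blockNegEquiv V) eR eS (degOnePDual Empty) Φ₂ ℓ) (A 0).x₀ N)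
  (hfin : ∀ kf : UnitaryGroup.finAdelic (↥(maximalRealSubfield L)) L (IsCMField.complexConj L) 3 V.Hm, kf ∈ Γ₀.K →
    ∀ Φinf : 𝓢((Fin 3 → mixedSpace (↥(maximalRealSubfield L))), ℂ),
      ((archSideOf V c hGR hGR₀ hGR₁ hGR₂ hGR₃ η hη hηc h₁W A).P 0).ω
          (HodgeCM.Adelic.regimeEquiv L V.Hm hV
            (UnitaryGroup.finAdelicToAdelic (↥(maximalRealSubfield L)) L (IsCMField.complexConj L) 3 V.Hm kf), 1)
          (testFun (↥(maximalRealSubfield L)) (Fin 3) Φinf (A 0).x₀ N) =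
        testFun (↥(maximalRealSubfield L)) (Fin 3) Φinf (A 0).x₀ N)
  (hsec : ∀ u : stabilizer U21 x₀,
    cmBlockSectionAt (L : Type) (frameD V) (frameD_real V) (frameD_ne V) (lineVec (L : Type) (dW c.D 0)) (fun _ => dW_real c.D 0)
        (fun _ => dW_ne c.D 0) ι₁ (cmPlace (L : Type) ι₁) (blockPosEquiv V) (blockNegEquiv V) eR eS (u21FrameEquiv (u : U21), 1) =
      (archSectionFrameOf V u, 1))
  {ev : VacExponents}
  (hK : ∀ (kk : DPK (Fin 2) Unit Unit Empty) (Φ : SchwartzMap (DPIdx (Fin 2) Unit Unit Empty → ℝ) ℂ),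
    cmBlockRepAt (L : Type) e₁ (frameD V) (frameD_real V) (frameD_ne V) (lineVec (L : Type) (dW c.D 0)) (fun _ => dW_real c.D 0)
        (fun _ => dW_ne c.D 0) hGR₀ ι₁ (cmPlace (L : Type) ι₁) (blockPosEquiv V) (blockNegEquiv V) eR eS
        (cmBlockSectionAt (L : Type) (frameD V) (frameD_real V) (frameD_ne V) (lineVec (L : Type) (dW c.D 0)) (fun _ => dW_real c.D 0)
          (fun _ => dW_ne c.D 0) ι₁ (cmPlace (L : Type) ι₁) (blockPosEquiv V) (blockNegEquiv V) eR eS (κ _ _ _ _ kk)) (tensorPi Φ Φ₂) =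
      tensorPi (κOp _ _ ev kk Φ) Φ₂)
  (hχ : ∀ u : stabilizer U21 x₀,
    ((lineScalar_zero V c.D hGR hGR₀ hGR₁ (eta₀ V c.D η) (u : U21) : ℂˣ) : ℂ) *
        ((matA (stabilizerEquivK21.symm u)).det ^ ev.eP * sclD (stabilizerEquivK21.symm u) ^ ev.eQ) =
      star (sclD (stabilizerEquivK21.symm u)))

/-- **ROW 12 FOR LINE 0 IN THE LITERAL SLOT** — `Φarch := blockFamilyOfAt … eR eS (degOnePDual Empty) Φ₂`; (Φ) discharged. -/
def archKTypeOfSlotZero :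
    ArchKTypeData (thetaSpaceInputIn hHD hI h₁ h₃ (archSideOf V c hGR hGR₀ hGR₁ hGR₂ hGR₃ η hη hηc h₁W A) hV) 0 N :=
  archKTypeOf hHD hI h₁ h₃ (archSideOf V c hGR hGR₀ hGR₁ hGR₂ hGR₃ η hη hηc h₁W A) hV 0 N Γ₀ Γ₀.K
    (satLevelRegimeOf_le_archFinOf V hV Γ₀.K) hlevel (fun _ hg => hg)
    (lineOmega_zero V c.D hGR hGR₀ hGR₁ (eta₀ V c.D η))
    (fun g => lineRepOf_zero_archInfOf_eq V c.D hGR hGR₀ hGR₁ hGR₂ hGR₃ (eta₀ V c.D η) (eta₁ V c.D η) (eta₂ V c.D η)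
      (eta₃ V c.D η) hV g)
    (blockFamilyOfAt (L : Type) e₁ (frameD V) (frameD_real V) (frameD_ne V) (lineVec (L : Type) (dW c.D 0)) (fun _ => dW_real c.D 0)
      (fun _ => dW_ne c.D 0) ι₁ (blockPosEquiv V) (blockNegEquiv V) eR eS (degOnePDual Empty) Φ₂)
    ℓ₀ arch₀
    (satLevel_fix_of_arch_of_fin (archSideOf V c hGR hGR₀ hGR₁ hGR₂ hGR₃ η hη hηc h₁W A) hV 0 N Γ₀.K
      (fun ℓ => blockFamilyOfAt (L : Type) e₁ (frameD V) (frameD_real V) (frameD_ne V) (lineVec (L : Type) (dW c.D 0))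
        (fun _ => dW_real c.D 0) (fun _ => dW_ne c.D 0) ι₁ (blockPosEquiv V) (blockNegEquiv V) eR eS (degOnePDual Empty) Φ₂ ℓ)
      harch hfin)
    (smulPull_blockFamilyOfAt_harm V e₁ (lineVec (L : Type) (dW c.D 0)) (fun _ => dW_real c.D 0) (fun _ => dW_ne c.D 0) hGR₀
      (lineScalar_zero V c.D hGR hGR₀ hGR₁ (eta₀ V c.D η)) eR eS (degOnePDual Empty) Φ₂ hsec hK
      (unitaryOpPi_dualPairι_degOnePDual Empty) hχ)

/-- `ωinf` of the slot term is `lineOmega_zero` (#CA1v4 `archKTypeOf_ωinf_apply`). -/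
theorem archKTypeOfSlotZero_ωinf_apply (g : U21) (Φ : 𝓢((Fin 3 → mixedSpace (↥(maximalRealSubfield L))), ℂ)) :
    (archKTypeOfSlotZero hHD hI h₁ h₃ V c hGR hGR₀ hGR₁ hGR₂ hGR₃ η hη hηc h₁W A hV N Γ₀ hlevel Φ₂ eR eS ℓ₀ arch₀ harch hfin
        hsec hK hχ).ωinf g Φ = lineOmega_zero V c.D hGR hGR₀ hGR₁ (eta₀ V c.D η) g Φ :=
  archKTypeOf_ωinf_apply hHD hI h₁ h₃ _ hV 0 N Γ₀ Γ₀.K _ hlevel _ _ _ _ ℓ₀ arch₀ _ _ g Φ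

/-- `Φarch` of the slot term (rfl). -/
theorem archKTypeOfSlotZero_Φarch :
    (archKTypeOfSlotZero hHD hI h₁ h₃ V c hGR hGR₀ hGR₁ hGR₂ hGR₃ η hη hηc h₁W A hV N Γ₀ hlevel Φ₂ eR eS ℓ₀ arch₀ harch hfin
        hsec hK hχ).Φarch =
      blockFamilyOfAt (L : Type) e₁ (frameD V) (frameD_real V) (frameD_ne V) (lineVec (L : Type) (dW c.D 0)) (fun _ => dW_real c.D 0)
        (fun _ => dW_ne c.D 0) ι₁ (blockPosEquiv V) (blockNegEquiv V) eR eS (degOnePDual Empty) Φ₂ :=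
  rfl

/-- `hωA` in the `…At` frame: `lineOmega_zero (twistU21 (expP b)) = cmArchWeilRep (cmBlockSectionAt … (u21FrameEquiv (expP b), 1))`. -/
theorem lineOmega_zero_twistU21_expP_At (b : Fin 2 → ℂ) :
    lineOmega_zero V c.D hGR hGR₀ hGR₁ (eta₀ V c.D η) (twistU21 L ι₁ (BallForms.expP b)) =
      cmArchWeilRep (L : Type) e₁ (frameD V) (frameD_real V) (frameD_ne V) (lineVec (L : Type) (dW c.D 0))
        (fun _ => dW_real c.D 0) (fun _ => dW_ne c.D 0) hGR₀
        (cmBlockSectionAt (L : Type) (frameD V) (frameD_real V) (frameD_ne V) (lineVec (L : Type) (dW c.D 0))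
          (fun _ => dW_real c.D 0) (fun _ => dW_ne c.D 0) ι₁ (cmPlace (L : Type) ι₁) (blockPosEquiv V) (blockNegEquiv V) eR eS
          (((u21FrameEquiv (BallForms.expP b) : UForm (Fin 2) Unit), (1 : UForm Unit Empty)) : Ginf (Fin 2) Unit Unit Empty)) := by
  rw [cmBlockSectionAt_inl_one, lineOmega_zero_twistU21_expP]

/-- the intertwining identity `hτ` of BRICK 4 for the slot term along `twistU21 ∘ expP`, `τ := F⁻¹`. -/
theorem archKTypeOfSlotZero_hτ (b : Fin 2 → ℂ)
    (x : SchwartzMap (DPIdx (Fin 2) Unit Unit Empty ⊕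
      (Fin 3 × {w : {w : InfinitePlace ↥(maximalRealSubfield L) // w.IsReal} // w ≠ cmPlace (L : Type) ι₁}) → ℝ) ℂ) :
    (archKTypeOfSlotZero hHD hI h₁ h₃ V c hGR hGR₀ hGR₁ hGR₂ hGR₃ η hη hηc h₁W A hV N Γ₀ hlevel Φ₂ eR eS ℓ₀ arch₀ harch hfin
        hsec hK hχ).ωinf (twistU21 L ι₁ (BallForms.expP b))
        (((cmBlockFrameAt (L : Type) e₁ (frameD V) (frameD_real V) (frameD_ne V) (lineVec (L : Type) (dW c.D 0))
          (fun _ => dW_real c.D 0) (fun _ => dW_ne c.D 0) ι₁ (cmPlace (L : Type) ι₁) (blockPosEquiv V) (blockNegEquiv V) eR eS).symm :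
            _ ≃L[ℂ] _) x) =
      ((cmBlockFrameAt (L : Type) e₁ (frameD V) (frameD_real V) (frameD_ne V) (lineVec (L : Type) (dW c.D 0))
          (fun _ => dW_real c.D 0) (fun _ => dW_ne c.D 0) ι₁ (cmPlace (L : Type) ι₁) (blockPosEquiv V) (blockNegEquiv V) eR eS).symm :
            _ ≃L[ℂ] _)
        (cmBlockRepAt (L : Type) e₁ (frameD V) (frameD_real V) (frameD_ne V) (lineVec (L : Type) (dW c.D 0)) (fun _ => dW_real c.D 0)
          (fun _ => dW_ne c.D 0) hGR₀ ι₁ (cmPlace (L : Type) ι₁) (blockPosEquiv V) (blockNegEquiv V) eR eS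
          (cmBlockSectionAt (L : Type) (frameD V) (frameD_real V) (frameD_ne V) (lineVec (L : Type) (dW c.D 0))
            (fun _ => dW_real c.D 0) (fun _ => dW_ne c.D 0) ι₁ (cmPlace (L : Type) ι₁) (blockPosEquiv V) (blockNegEquiv V) eR eS
            (((u21FrameEquiv (BallForms.expP b) : UForm (Fin 2) Unit), (1 : UForm Unit Empty)) : Ginf (Fin 2) Unit Unit Empty)) x) := by
  rw [archKTypeOfSlotZero_ωinf_apply, lineOmega_zero_twistU21_expP_At, cmArchWeilRep_cmBlockFrameAt_symm]

set_option backward.isDefEq.respectTransparency false in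
/-- **ROW 14 FOR LINE 0 IN THE LITERAL SLOT — NO HYPOTHESIS BEYOND THE TERM'S INPUTS.** -/
theorem isWeaklyPDiff_archKTypeOfSlotZero :
    (archKTypeOfSlotZero hHD hI h₁ h₃ V c hGR hGR₀ hGR₁ hGR₂ hGR₃ η hη hηc h₁W A hV N Γ₀ hlevel Φ₂ eR eS ℓ₀ arch₀ harch hfin
        hsec hK hχ).IsWeaklyPDiff BallForms.expP := by
  obtain ⟨ω₁, hW₁, hc₁⟩ := exists_isArchWeilDatum_lineSlot (R := Unit) (S := Empty)
  obtain ⟨ev₁, hvac₁⟩ := (junction (Fin 2) Unit Unit Empty).exists_vacExponents hW₁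
  refine (ArchKTypeData.isWeaklyPDiff_twistVec_iff
    (X := thetaSpaceInputIn hHD hI h₁ h₃ (archSideOf V c hGR hGR₀ hGR₁ hGR₂ hGR₃ η hη hηc h₁W A) hV) _ BallForms.expP).1 ?_
  rw [← twistU21_comp_expP]
  exact ArchKTypeData.isWeaklyPDiff_of_blockPair
    (X := thetaSpaceInputIn hHD hI h₁ h₃ (archSideOf V c hGR hGR₀ hGR₁ hGR₂ hGR₃ η hη hηc h₁W A) hV) _
    (isArchWeilDatum_cmBlockAt (L : Type) e₁ (frameD V) (frameD_real V) (frameD_ne V) (lineVec (L : Type) (dW c.D 0))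
      (fun _ => dW_real c.D 0) (fun _ => dW_ne c.D 0) hGR₀ ι₁ (cmPlace (L : Type) ι₁) (blockPosEquiv V) (blockNegEquiv V) eR eS
      (frameD_sign_ι₁' V) (line_hs₁W h₁W 0) (frameD_sign_of_ne V) (fun τ hτ => line_hsW (dW c.D 0) τ hτ))
    (continuous_cmBlockRepAt (L : Type) e₁ (frameD V) (frameD_real V) (frameD_ne V) (lineVec (L : Type) (dW c.D 0))
      (fun _ => dW_real c.D 0) (fun _ => dW_ne c.D 0) hGR₀ ι₁ (cmPlace (L : Type) ι₁) (blockPosEquiv V) (blockNegEquiv V) eR eS)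
    hW₁ hc₁ hvac₁
    (cmBlockSectionAt (L : Type) (frameD V) (frameD_real V) (frameD_ne V) (lineVec (L : Type) (dW c.D 0)) (fun _ => dW_real c.D 0)
      (fun _ => dW_ne c.D 0) ι₁ (cmPlace (L : Type) ι₁) (blockPosEquiv V) (blockNegEquiv V) eR eS)
    (continuous_cmBlockSectionAt (L : Type) (frameD V) (frameD_real V) (frameD_ne V) (lineVec (L : Type) (dW c.D 0))
      (fun _ => dW_real c.D 0) (fun _ => dW_ne c.D 0) ι₁ (cmPlace (L : Type) ι₁) (blockPosEquiv V) (blockNegEquiv V) eR eS)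
    (coe_cmBlockPhaseHomAt_cmBlockSectionAt (L : Type) e₁ (frameD V) (frameD_real V) (frameD_ne V) (lineVec (L : Type) (dW c.D 0))
      (fun _ => dW_real c.D 0) (fun _ => dW_ne c.D 0) ι₁ (cmPlace (L : Type) ι₁) (blockPosEquiv V) (blockNegEquiv V) eR eS)
    (fun b => twistU21 L ι₁ (BallForms.expP b))
    ((cmBlockFrameAt (L : Type) e₁ (frameD V) (frameD_real V) (frameD_ne V) (lineVec (L : Type) (dW c.D 0)) (fun _ => dW_real c.D 0)
      (fun _ => dW_ne c.D 0) ι₁ (cmPlace (L : Type) ι₁) (blockPosEquiv V) (blockNegEquiv V) eR eS).symm.toContinuousLinearMap)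
    (archKTypeOfSlotZero_hτ hHD hI h₁ h₃ V c hGR hGR₀ hGR₁ hGR₂ hGR₃ η hη hηc h₁W A hV N Γ₀ hlevel Φ₂ eR eS ℓ₀ arch₀ harch hfin
      hsec hK hχ)
    Φ₂ (degOnePDual Empty) (fun _ => rfl)

set_option backward.isDefEq.respectTransparency false in
/-- **ROW 15 FOR LINE 0 IN THE LITERAL SLOT ALONG `twistU21 ∘ expP` — NO HYPOTHESIS BEYOND THE TERM'S INPUTS** (`hf` = § 4);
the `expP` form is the (TWIST-2) item. -/
theorem isPMinusKilledAlong_archKTypeOfSlotZero_twist (p : Fin 2) :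
    (archKTypeOfSlotZero hHD hI h₁ h₃ V c hGR hGR₀ hGR₁ hGR₂ hGR₃ η hη hηc h₁W A hV N Γ₀ hlevel Φ₂ eR eS ℓ₀ arch₀ harch hfin
        hsec hK hχ).IsPMinusKilledAlong (fun b => twistU21 L ι₁ (BallForms.expP b)) (-Complex.I • (Pi.single p 1 : Fin 2 → ℂ)) := by
  obtain ⟨ω₁, hW₁, hc₁⟩ := exists_isArchWeilDatum_lineSlot (R := Unit) (S := Empty)
  exact ArchKTypeData.isPMinusKilledAlong_of_blockPair
    (X := thetaSpaceInputIn hHD hI h₁ h₃ (archSideOf V c hGR hGR₀ hGR₁ hGR₂ hGR₃ η hη hηc h₁W A) hV) _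
    (isArchWeilDatum_cmBlockAt (L : Type) e₁ (frameD V) (frameD_real V) (frameD_ne V) (lineVec (L : Type) (dW c.D 0))
      (fun _ => dW_real c.D 0) (fun _ => dW_ne c.D 0) hGR₀ ι₁ (cmPlace (L : Type) ι₁) (blockPosEquiv V) (blockNegEquiv V) eR eS
      (frameD_sign_ι₁' V) (line_hs₁W h₁W 0) (frameD_sign_of_ne V) (fun τ hτ => line_hsW (dW c.D 0) τ hτ))
    (continuous_cmBlockRepAt (L : Type) e₁ (frameD V) (frameD_real V) (frameD_ne V) (lineVec (L : Type) (dW c.D 0))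
      (fun _ => dW_real c.D 0) (fun _ => dW_ne c.D 0) hGR₀ ι₁ (cmPlace (L : Type) ι₁) (blockPosEquiv V) (blockNegEquiv V) eR eS)
    hW₁ hc₁
    (cmBlockSectionAt (L : Type) (frameD V) (frameD_real V) (frameD_ne V) (lineVec (L : Type) (dW c.D 0)) (fun _ => dW_real c.D 0)
      (fun _ => dW_ne c.D 0) ι₁ (cmPlace (L : Type) ι₁) (blockPosEquiv V) (blockNegEquiv V) eR eS)
    (continuous_cmBlockSectionAt (L : Type) (frameD V) (frameD_real V) (frameD_ne V) (lineVec (L : Type) (dW c.D 0))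
      (fun _ => dW_real c.D 0) (fun _ => dW_ne c.D 0) ι₁ (cmPlace (L : Type) ι₁) (blockPosEquiv V) (blockNegEquiv V) eR eS)
    (coe_cmBlockPhaseHomAt_cmBlockSectionAt (L : Type) e₁ (frameD V) (frameD_real V) (frameD_ne V) (lineVec (L : Type) (dW c.D 0))
      (fun _ => dW_real c.D 0) (fun _ => dW_ne c.D 0) ι₁ (cmPlace (L : Type) ι₁) (blockPosEquiv V) (blockNegEquiv V) eR eS)
    (fun b => twistU21 L ι₁ (BallForms.expP b))
    ((cmBlockFrameAt (L : Type) e₁ (frameD V) (frameD_real V) (frameD_ne V) (lineVec (L : Type) (dW c.D 0)) (fun _ => dW_real c.D 0)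
      (fun _ => dW_ne c.D 0) ι₁ (cmPlace (L : Type) ι₁) (blockPosEquiv V) (blockNegEquiv V) eR eS).symm.toContinuousLinearMap)
    (archKTypeOfSlotZero_hτ hHD hI h₁ h₃ V c hGR hGR₀ hGR₁ hGR₂ hGR₃ η hη hηc h₁W A hV N Γ₀ hlevel Φ₂ eR eS ℓ₀ arch₀ harch hfin
      hsec hK hχ)
    Φ₂ (degOnePDual Empty) (fun _ => rfl) (hypOpGen_add_I_smul_rotBoostGen_degOnePDual Empty) p

end Zero

/-! ### line 1 -/

section One

variable
  (eR : PosIdx (cmXW (L : Type) (frameD V) (lineVec (L : Type) (dW c.D 1)) (fun _ => dW_real c.D 1) ι₁ (cmPlace (L : Type) ι₁)) ≃ Unit)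
  (eS : NegIdx (cmXW (L : Type) (frameD V) (lineVec (L : Type) (dW c.D 1)) (fun _ => dW_real c.D 1) ι₁ (cmPlace (L : Type) ι₁)) ≃ Empty)
  (ℓ₀ : Module.Dual ℂ (Fin 2 → ℂ))
  (arch₀ : blockFamilyOfAt (L : Type) e₁ (frameD V) (frameD_real V) (frameD_ne V) (lineVec (L : Type) (dW c.D 1))
      (fun _ => dW_real c.D 1) (fun _ => dW_ne c.D 1) ι₁ (blockPosEquiv V) (blockNegEquiv V) eR eS (degOnePDual Empty) Φ₂ ℓ₀ =
    (A 1).Φinf)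
  (harch : ∀ a : UnitaryGroup.arch (↥(maximalRealSubfield L)) L (IsCMField.complexConj L) 3 V.Hm,
    UnitaryGroup.archAt (↥(maximalRealSubfield L)) L (IsCMField.complexConj L) 3 V.Hm (UnitaryGroup.cmPlace (L : Type) ι₁)
        (NumberField.complexConj_smul_infinitePlace (L : Type) _) (IsCMField.complexConj_ne_one (L : Type)) a = 1 →
    ∀ ℓ, ((archSideOf V c hGR hGR₀ hGR₁ hGR₂ hGR₃ η hη hηc h₁W A).P 1).ω
        (HodgeCM.Adelic.regimeEquiv L V.Hm hV
          (UnitaryGroup.archToAdelic (↥(maximalRealSubfield L)) L (IsCMField.complexConj L) 3 V.Hm a), 1)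
        (testFun (↥(maximalRealSubfield L)) (Fin 3)
          (blockFamilyOfAt (L : Type) e₁ (frameD V) (frameD_real V) (frameD_ne V) (lineVec (L : Type) (dW c.D 1))
            (fun _ => dW_real c.D 1) (fun _ => dW_ne c.D 1) ι₁ (blockPosEquiv V) (blockNegEquiv V) eR eS (degOnePDual Empty) Φ₂ ℓ)
          (A 1).x₀ N) =
      testFun (↥(maximalRealSubfield L)) (Fin 3)
        (blockFamilyOfAt (L : Type) e₁ (frameD V) (frameD_real V) (frameD_ne V) (lineVec (L : Type) (dW c.D 1))
          (fun _ => dW_real c.D 1) (fun _ => dW_ne c.D 1) ι₁ (blockPosEquiv V) (blockNegEquiv V) eR eS (degOnePDual Empty) Φ₂ ℓ) (A 1).x₀ N)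
  (hfin : ∀ kf : UnitaryGroup.finAdelic (↥(maximalRealSubfield L)) L (IsCMField.complexConj L) 3 V.Hm, kf ∈ Γ₀.K →
    ∀ Φinf : 𝓢((Fin 3 → mixedSpace (↥(maximalRealSubfield L))), ℂ),
      ((archSideOf V c hGR hGR₀ hGR₁ hGR₂ hGR₃ η hη hηc h₁W A).P 1).ω
          (HodgeCM.Adelic.regimeEquiv L V.Hm hV
            (UnitaryGroup.finAdelicToAdelic (↥(maximalRealSubfield L)) L (IsCMField.complexConj L) 3 V.Hm kf), 1)
          (testFun (↥(maximalRealSubfield L)) (Fin 3) Φinf (A 1).x₀ N) =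
        testFun (↥(maximalRealSubfield L)) (Fin 3) Φinf (A 1).x₀ N)
  (hsec : ∀ u : stabilizer U21 x₀,
    cmBlockSectionAt (L : Type) (frameD V) (frameD_real V) (frameD_ne V) (lineVec (L : Type) (dW c.D 1)) (fun _ => dW_real c.D 1)
        (fun _ => dW_ne c.D 1) ι₁ (cmPlace (L : Type) ι₁) (blockPosEquiv V) (blockNegEquiv V) eR eS (u21FrameEquiv (u : U21), 1) =
      (archSectionFrameOf V u, 1))
  {ev : VacExponents}
  (hK : ∀ (kk : DPK (Fin 2) Unit Unit Empty) (Φ : SchwartzMap (DPIdx (Fin 2) Unit Unit Empty → ℝ) ℂ),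
    cmBlockRepAt (L : Type) e₁ (frameD V) (frameD_real V) (frameD_ne V) (lineVec (L : Type) (dW c.D 1)) (fun _ => dW_real c.D 1)
        (fun _ => dW_ne c.D 1) hGR₁ ι₁ (cmPlace (L : Type) ι₁) (blockPosEquiv V) (blockNegEquiv V) eR eS
        (cmBlockSectionAt (L : Type) (frameD V) (frameD_real V) (frameD_ne V) (lineVec (L : Type) (dW c.D 1)) (fun _ => dW_real c.D 1)
          (fun _ => dW_ne c.D 1) ι₁ (cmPlace (L : Type) ι₁) (blockPosEquiv V) (blockNegEquiv V) eR eS (κ _ _ _ _ kk)) (tensorPi Φ Φ₂) =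
      tensorPi (κOp _ _ ev kk Φ) Φ₂)
  (hχ : ∀ u : stabilizer U21 x₀,
    ((lineScalar_one V c.D hGR hGR₀ hGR₁ (eta₁ V c.D η) (u : U21) : ℂˣ) : ℂ) *
        ((matA (stabilizerEquivK21.symm u)).det ^ ev.eP * sclD (stabilizerEquivK21.symm u) ^ ev.eQ) =
      star (sclD (stabilizerEquivK21.symm u)))

/-- **ROW 12 FOR LINE 1 IN THE LITERAL SLOT** — `Φarch := blockFamilyOfAt … eR eS (degOnePDual Empty) Φ₂`; (Φ) discharged. -/
def archKTypeOfSlotOne :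
    ArchKTypeData (thetaSpaceInputIn hHD hI h₁ h₃ (archSideOf V c hGR hGR₀ hGR₁ hGR₂ hGR₃ η hη hηc h₁W A) hV) 1 N :=
  archKTypeOf hHD hI h₁ h₃ (archSideOf V c hGR hGR₀ hGR₁ hGR₂ hGR₃ η hη hηc h₁W A) hV 1 N Γ₀ Γ₀.K
    (satLevelRegimeOf_le_archFinOf V hV Γ₀.K) hlevel (fun _ hg => hg)
    (lineOmega_one V c.D hGR hGR₀ hGR₁ (eta₁ V c.D η))
    (fun g => lineRepOf_one_archInfOf_eq V c.D hGR hGR₀ hGR₁ hGR₂ hGR₃ (eta₀ V c.D η) (eta₁ V c.D η) (eta₂ V c.D η)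
      (eta₃ V c.D η) hV g)
    (blockFamilyOfAt (L : Type) e₁ (frameD V) (frameD_real V) (frameD_ne V) (lineVec (L : Type) (dW c.D 1)) (fun _ => dW_real c.D 1)
      (fun _ => dW_ne c.D 1) ι₁ (blockPosEquiv V) (blockNegEquiv V) eR eS (degOnePDual Empty) Φ₂)
    ℓ₀ arch₀
    (satLevel_fix_of_arch_of_fin (archSideOf V c hGR hGR₀ hGR₁ hGR₂ hGR₃ η hη hηc h₁W A) hV 1 N Γ₀.K
      (fun ℓ => blockFamilyOfAt (L : Type) e₁ (frameD V) (frameD_real V) (frameD_ne V) (lineVec (L : Type) (dW c.D 1))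
        (fun _ => dW_real c.D 1) (fun _ => dW_ne c.D 1) ι₁ (blockPosEquiv V) (blockNegEquiv V) eR eS (degOnePDual Empty) Φ₂ ℓ)
      harch hfin)
    (smulPull_blockFamilyOfAt_harm V e₁ (lineVec (L : Type) (dW c.D 1)) (fun _ => dW_real c.D 1) (fun _ => dW_ne c.D 1) hGR₁
      (lineScalar_one V c.D hGR hGR₀ hGR₁ (eta₁ V c.D η)) eR eS (degOnePDual Empty) Φ₂ hsec hK
      (unitaryOpPi_dualPairι_degOnePDual Empty) hχ)

/-- `ωinf` of the slot term is `lineOmega_one` (#CA1v4 `archKTypeOf_ωinf_apply`). -/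
theorem archKTypeOfSlotOne_ωinf_apply (g : U21) (Φ : 𝓢((Fin 3 → mixedSpace (↥(maximalRealSubfield L))), ℂ)) :
    (archKTypeOfSlotOne hHD hI h₁ h₃ V c hGR hGR₀ hGR₁ hGR₂ hGR₃ η hη hηc h₁W A hV N Γ₀ hlevel Φ₂ eR eS ℓ₀ arch₀ harch hfin
        hsec hK hχ).ωinf g Φ = lineOmega_one V c.D hGR hGR₀ hGR₁ (eta₁ V c.D η) g Φ :=
  archKTypeOf_ωinf_apply hHD hI h₁ h₃ _ hV 1 N Γ₀ Γ₀.K _ hlevel _ _ _ _ ℓ₀ arch₀ _ _ g Φ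

/-- `Φarch` of the slot term (rfl). -/
theorem archKTypeOfSlotOne_Φarch :
    (archKTypeOfSlotOne hHD hI h₁ h₃ V c hGR hGR₀ hGR₁ hGR₂ hGR₃ η hη hηc h₁W A hV N Γ₀ hlevel Φ₂ eR eS ℓ₀ arch₀ harch hfin
        hsec hK hχ).Φarch =
      blockFamilyOfAt (L : Type) e₁ (frameD V) (frameD_real V) (frameD_ne V) (lineVec (L : Type) (dW c.D 1)) (fun _ => dW_real c.D 1)
        (fun _ => dW_ne c.D 1) ι₁ (blockPosEquiv V) (blockNegEquiv V) eR eS (degOnePDual Empty) Φ₂ :=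
  rfl

/-- `hωA` in the `…At` frame: `lineOmega_one (twistU21 (expP b)) = cmArchWeilRep (cmBlockSectionAt … (u21FrameEquiv (expP b), 1))`. -/
theorem lineOmega_one_twistU21_expP_At (b : Fin 2 → ℂ) :
    lineOmega_one V c.D hGR hGR₀ hGR₁ (eta₁ V c.D η) (twistU21 L ι₁ (BallForms.expP b)) =
      cmArchWeilRep (L : Type) e₁ (frameD V) (frameD_real V) (frameD_ne V) (lineVec (L : Type) (dW c.D 1))
        (fun _ => dW_real c.D 1) (fun _ => dW_ne c.D 1) hGR₁
        (cmBlockSectionAt (L : Type) (frameD V) (frameD_real V) (frameD_ne V) (lineVec (L : Type) (dW c.D 1))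
          (fun _ => dW_real c.D 1) (fun _ => dW_ne c.D 1) ι₁ (cmPlace (L : Type) ι₁) (blockPosEquiv V) (blockNegEquiv V) eR eS
          (((u21FrameEquiv (BallForms.expP b) : UForm (Fin 2) Unit), (1 : UForm Unit Empty)) : Ginf (Fin 2) Unit Unit Empty)) := by
  rw [cmBlockSectionAt_inl_one, lineOmega_one_twistU21_expP]

/-- the intertwining identity `hτ` of BRICK 4 for the slot term along `twistU21 ∘ expP`, `τ := F⁻¹`. -/
theorem archKTypeOfSlotOne_hτ (b : Fin 2 → ℂ)
    (x : SchwartzMap (DPIdx (Fin 2) Unit Unit Empty ⊕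
      (Fin 3 × {w : {w : InfinitePlace ↥(maximalRealSubfield L) // w.IsReal} // w ≠ cmPlace (L : Type) ι₁}) → ℝ) ℂ) :
    (archKTypeOfSlotOne hHD hI h₁ h₃ V c hGR hGR₀ hGR₁ hGR₂ hGR₃ η hη hηc h₁W A hV N Γ₀ hlevel Φ₂ eR eS ℓ₀ arch₀ harch hfin
        hsec hK hχ).ωinf (twistU21 L ι₁ (BallForms.expP b))
        (((cmBlockFrameAt (L : Type) e₁ (frameD V) (frameD_real V) (frameD_ne V) (lineVec (L : Type) (dW c.D 1))
          (fun _ => dW_real c.D 1) (fun _ => dW_ne c.D 1) ι₁ (cmPlace (L : Type) ι₁) (blockPosEquiv V) (blockNegEquiv V) eR eS).symm :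
            _ ≃L[ℂ] _) x) =
      ((cmBlockFrameAt (L : Type) e₁ (frameD V) (frameD_real V) (frameD_ne V) (lineVec (L : Type) (dW c.D 1))
          (fun _ => dW_real c.D 1) (fun _ => dW_ne c.D 1) ι₁ (cmPlace (L : Type) ι₁) (blockPosEquiv V) (blockNegEquiv V) eR eS).symm :
            _ ≃L[ℂ] _)
        (cmBlockRepAt (L : Type) e₁ (frameD V) (frameD_real V) (frameD_ne V) (lineVec (L : Type) (dW c.D 1)) (fun _ => dW_real c.D 1)
          (fun _ => dW_ne c.D 1) hGR₁ ι₁ (cmPlace (L : Type) ι₁) (blockPosEquiv V) (blockNegEquiv V) eR eS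
          (cmBlockSectionAt (L : Type) (frameD V) (frameD_real V) (frameD_ne V) (lineVec (L : Type) (dW c.D 1))
            (fun _ => dW_real c.D 1) (fun _ => dW_ne c.D 1) ι₁ (cmPlace (L : Type) ι₁) (blockPosEquiv V) (blockNegEquiv V) eR eS
            (((u21FrameEquiv (BallForms.expP b) : UForm (Fin 2) Unit), (1 : UForm Unit Empty)) : Ginf (Fin 2) Unit Unit Empty)) x) := by
  rw [archKTypeOfSlotOne_ωinf_apply, lineOmega_one_twistU21_expP_At, cmArchWeilRep_cmBlockFrameAt_symm]

set_option backward.isDefEq.respectTransparency false in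
/-- **ROW 14 FOR LINE 1 IN THE LITERAL SLOT — NO HYPOTHESIS BEYOND THE TERM'S INPUTS.** -/
theorem isWeaklyPDiff_archKTypeOfSlotOne :
    (archKTypeOfSlotOne hHD hI h₁ h₃ V c hGR hGR₀ hGR₁ hGR₂ hGR₃ η hη hηc h₁W A hV N Γ₀ hlevel Φ₂ eR eS ℓ₀ arch₀ harch hfin
        hsec hK hχ).IsWeaklyPDiff BallForms.expP := by
  obtain ⟨ω₁, hW₁, hc₁⟩ := exists_isArchWeilDatum_lineSlot (R := Unit) (S := Empty)
  obtain ⟨ev₁, hvac₁⟩ := (junction (Fin 2) Unit Unit Empty).exists_vacExponents hW₁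
  refine (ArchKTypeData.isWeaklyPDiff_twistVec_iff
    (X := thetaSpaceInputIn hHD hI h₁ h₃ (archSideOf V c hGR hGR₀ hGR₁ hGR₂ hGR₃ η hη hηc h₁W A) hV) _ BallForms.expP).1 ?_
  rw [← twistU21_comp_expP]
  exact ArchKTypeData.isWeaklyPDiff_of_blockPair
    (X := thetaSpaceInputIn hHD hI h₁ h₃ (archSideOf V c hGR hGR₀ hGR₁ hGR₂ hGR₃ η hη hηc h₁W A) hV) _
    (isArchWeilDatum_cmBlockAt (L : Type) e₁ (frameD V) (frameD_real V) (frameD_ne V) (lineVec (L : Type) (dW c.D 1))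
      (fun _ => dW_real c.D 1) (fun _ => dW_ne c.D 1) hGR₁ ι₁ (cmPlace (L : Type) ι₁) (blockPosEquiv V) (blockNegEquiv V) eR eS
      (frameD_sign_ι₁' V) (line_hs₁W h₁W 1) (frameD_sign_of_ne V) (fun τ hτ => line_hsW (dW c.D 1) τ hτ))
    (continuous_cmBlockRepAt (L : Type) e₁ (frameD V) (frameD_real V) (frameD_ne V) (lineVec (L : Type) (dW c.D 1))
      (fun _ => dW_real c.D 1) (fun _ => dW_ne c.D 1) hGR₁ ι₁ (cmPlace (L : Type) ι₁) (blockPosEquiv V) (blockNegEquiv V) eR eS)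
    hW₁ hc₁ hvac₁
    (cmBlockSectionAt (L : Type) (frameD V) (frameD_real V) (frameD_ne V) (lineVec (L : Type) (dW c.D 1)) (fun _ => dW_real c.D 1)
      (fun _ => dW_ne c.D 1) ι₁ (cmPlace (L : Type) ι₁) (blockPosEquiv V) (blockNegEquiv V) eR eS)
    (continuous_cmBlockSectionAt (L : Type) (frameD V) (frameD_real V) (frameD_ne V) (lineVec (L : Type) (dW c.D 1))
      (fun _ => dW_real c.D 1) (fun _ => dW_ne c.D 1) ι₁ (cmPlace (L : Type) ι₁) (blockPosEquiv V) (blockNegEquiv V) eR eS)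
    (coe_cmBlockPhaseHomAt_cmBlockSectionAt (L : Type) e₁ (frameD V) (frameD_real V) (frameD_ne V) (lineVec (L : Type) (dW c.D 1))
      (fun _ => dW_real c.D 1) (fun _ => dW_ne c.D 1) ι₁ (cmPlace (L : Type) ι₁) (blockPosEquiv V) (blockNegEquiv V) eR eS)
    (fun b => twistU21 L ι₁ (BallForms.expP b))
    ((cmBlockFrameAt (L : Type) e₁ (frameD V) (frameD_real V) (frameD_ne V) (lineVec (L : Type) (dW c.D 1)) (fun _ => dW_real c.D 1)
      (fun _ => dW_ne c.D 1) ι₁ (cmPlace (L : Type) ι₁) (blockPosEquiv V) (blockNegEquiv V) eR eS).symm.toContinuousLinearMap)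
    (archKTypeOfSlotOne_hτ hHD hI h₁ h₃ V c hGR hGR₀ hGR₁ hGR₂ hGR₃ η hη hηc h₁W A hV N Γ₀ hlevel Φ₂ eR eS ℓ₀ arch₀ harch hfin
      hsec hK hχ)
    Φ₂ (degOnePDual Empty) (fun _ => rfl)

set_option backward.isDefEq.respectTransparency false in
/-- **ROW 15 FOR LINE 1 IN THE LITERAL SLOT ALONG `twistU21 ∘ expP` — NO HYPOTHESIS BEYOND THE TERM'S INPUTS** (`hf` = § 4);
the `expP` form is the (TWIST-2) item. -/
theorem isPMinusKilledAlong_archKTypeOfSlotOne_twist (p : Fin 2) :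
    (archKTypeOfSlotOne hHD hI h₁ h₃ V c hGR hGR₀ hGR₁ hGR₂ hGR₃ η hη hηc h₁W A hV N Γ₀ hlevel Φ₂ eR eS ℓ₀ arch₀ harch hfin
        hsec hK hχ).IsPMinusKilledAlong (fun b => twistU21 L ι₁ (BallForms.expP b)) (-Complex.I • (Pi.single p 1 : Fin 2 → ℂ)) := by
  obtain ⟨ω₁, hW₁, hc₁⟩ := exists_isArchWeilDatum_lineSlot (R := Unit) (S := Empty)
  exact ArchKTypeData.isPMinusKilledAlong_of_blockPair
    (X := thetaSpaceInputIn hHD hI h₁ h₃ (archSideOf V c hGR hGR₀ hGR₁ hGR₂ hGR₃ η hη hηc h₁W A) hV) _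
    (isArchWeilDatum_cmBlockAt (L : Type) e₁ (frameD V) (frameD_real V) (frameD_ne V) (lineVec (L : Type) (dW c.D 1))
      (fun _ => dW_real c.D 1) (fun _ => dW_ne c.D 1) hGR₁ ι₁ (cmPlace (L : Type) ι₁) (blockPosEquiv V) (blockNegEquiv V) eR eS
      (frameD_sign_ι₁' V) (line_hs₁W h₁W 1) (frameD_sign_of_ne V) (fun τ hτ => line_hsW (dW c.D 1) τ hτ))
    (continuous_cmBlockRepAt (L : Type) e₁ (frameD V) (frameD_real V) (frameD_ne V) (lineVec (L : Type) (dW c.D 1))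
      (fun _ => dW_real c.D 1) (fun _ => dW_ne c.D 1) hGR₁ ι₁ (cmPlace (L : Type) ι₁) (blockPosEquiv V) (blockNegEquiv V) eR eS)
    hW₁ hc₁
    (cmBlockSectionAt (L : Type) (frameD V) (frameD_real V) (frameD_ne V) (lineVec (L : Type) (dW c.D 1)) (fun _ => dW_real c.D 1)
      (fun _ => dW_ne c.D 1) ι₁ (cmPlace (L : Type) ι₁) (blockPosEquiv V) (blockNegEquiv V) eR eS)
    (continuous_cmBlockSectionAt (L : Type) (frameD V) (frameD_real V) (frameD_ne V) (lineVec (L : Type) (dW c.D 1))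
      (fun _ => dW_real c.D 1) (fun _ => dW_ne c.D 1) ι₁ (cmPlace (L : Type) ι₁) (blockPosEquiv V) (blockNegEquiv V) eR eS)
    (coe_cmBlockPhaseHomAt_cmBlockSectionAt (L : Type) e₁ (frameD V) (frameD_real V) (frameD_ne V) (lineVec (L : Type) (dW c.D 1))
      (fun _ => dW_real c.D 1) (fun _ => dW_ne c.D 1) ι₁ (cmPlace (L : Type) ι₁) (blockPosEquiv V) (blockNegEquiv V) eR eS)
    (fun b => twistU21 L ι₁ (BallForms.expP b))
    ((cmBlockFrameAt (L : Type) e₁ (frameD V) (frameD_real V) (frameD_ne V) (lineVec (L : Type) (dW c.D 1)) (fun _ => dW_real c.D 1)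
      (fun _ => dW_ne c.D 1) ι₁ (cmPlace (L : Type) ι₁) (blockPosEquiv V) (blockNegEquiv V) eR eS).symm.toContinuousLinearMap)
    (archKTypeOfSlotOne_hτ hHD hI h₁ h₃ V c hGR hGR₀ hGR₁ hGR₂ hGR₃ η hη hηc h₁W A hV N Γ₀ hlevel Φ₂ eR eS ℓ₀ arch₀ harch hfin
      hsec hK hχ)
    Φ₂ (degOnePDual Empty) (fun _ => rfl) (hypOpGen_add_I_smul_rotBoostGen_degOnePDual Empty) p

end One

/-! ### E's binder shape in the literal slot: the `k`-dispatched term for `k = 0 ∨ k = 1` -/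

section Dispatch

variable
  (eR₀' : PosIdx (cmXW (L : Type) (frameD V) (lineVec (L : Type) (dW c.D 0)) (fun _ => dW_real c.D 0) ι₁ (cmPlace (L : Type) ι₁)) ≃ Unit)
  (eS₀' : NegIdx (cmXW (L : Type) (frameD V) (lineVec (L : Type) (dW c.D 0)) (fun _ => dW_real c.D 0) ι₁ (cmPlace (L : Type) ι₁)) ≃ Empty)
  (ℓ₀₀' : Module.Dual ℂ (Fin 2 → ℂ))
  (arch₀₀' : blockFamilyOfAt (L : Type) e₁ (frameD V) (frameD_real V) (frameD_ne V) (lineVec (L : Type) (dW c.D 0))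
      (fun _ => dW_real c.D 0) (fun _ => dW_ne c.D 0) ι₁ (blockPosEquiv V) (blockNegEquiv V) eR₀' eS₀' (degOnePDual Empty) Φ₂ ℓ₀₀' =
    (A 0).Φinf)
  (harch₀' : ∀ a : UnitaryGroup.arch (↥(maximalRealSubfield L)) L (IsCMField.complexConj L) 3 V.Hm,
    UnitaryGroup.archAt (↥(maximalRealSubfield L)) L (IsCMField.complexConj L) 3 V.Hm (UnitaryGroup.cmPlace (L : Type) ι₁)
        (NumberField.complexConj_smul_infinitePlace (L : Type) _) (IsCMField.complexConj_ne_one (L : Type)) a = 1 →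
    ∀ ℓ, ((archSideOf V c hGR hGR₀ hGR₁ hGR₂ hGR₃ η hη hηc h₁W A).P 0).ω
        (HodgeCM.Adelic.regimeEquiv L V.Hm hV
          (UnitaryGroup.archToAdelic (↥(maximalRealSubfield L)) L (IsCMField.complexConj L) 3 V.Hm a), 1)
        (testFun (↥(maximalRealSubfield L)) (Fin 3)
          (blockFamilyOfAt (L : Type) e₁ (frameD V) (frameD_real V) (frameD_ne V) (lineVec (L : Type) (dW c.D 0))
            (fun _ => dW_real c.D 0) (fun _ => dW_ne c.D 0) ι₁ (blockPosEquiv V) (blockNegEquiv V) eR₀' eS₀' (degOnePDual Empty) Φ₂ ℓ)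
          (A 0).x₀ N) =
      testFun (↥(maximalRealSubfield L)) (Fin 3)
        (blockFamilyOfAt (L : Type) e₁ (frameD V) (frameD_real V) (frameD_ne V) (lineVec (L : Type) (dW c.D 0))
          (fun _ => dW_real c.D 0) (fun _ => dW_ne c.D 0) ι₁ (blockPosEquiv V) (blockNegEquiv V) eR₀' eS₀' (degOnePDual Empty) Φ₂ ℓ) (A 0).x₀ N)
  (hfin₀' : ∀ kf : UnitaryGroup.finAdelic (↥(maximalRealSubfield L)) L (IsCMField.complexConj L) 3 V.Hm, kf ∈ Γ₀.K →
    ∀ Φinf : 𝓢((Fin 3 → mixedSpace (↥(maximalRealSubfield L))), ℂ),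
      ((archSideOf V c hGR hGR₀ hGR₁ hGR₂ hGR₃ η hη hηc h₁W A).P 0).ω
          (HodgeCM.Adelic.regimeEquiv L V.Hm hV
            (UnitaryGroup.finAdelicToAdelic (↥(maximalRealSubfield L)) L (IsCMField.complexConj L) 3 V.Hm kf), 1)
          (testFun (↥(maximalRealSubfield L)) (Fin 3) Φinf (A 0).x₀ N) =
        testFun (↥(maximalRealSubfield L)) (Fin 3) Φinf (A 0).x₀ N)
  (hsec₀' : ∀ u : stabilizer U21 x₀,
    cmBlockSectionAt (L : Type) (frameD V) (frameD_real V) (frameD_ne V) (lineVec (L : Type) (dW c.D 0)) (fun _ => dW_real c.D 0)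
        (fun _ => dW_ne c.D 0) ι₁ (cmPlace (L : Type) ι₁) (blockPosEquiv V) (blockNegEquiv V) eR₀' eS₀' (u21FrameEquiv (u : U21), 1) =
      (archSectionFrameOf V u, 1))
  {ev₀' : VacExponents}
  (hK₀' : ∀ (kk : DPK (Fin 2) Unit Unit Empty) (Φ : SchwartzMap (DPIdx (Fin 2) Unit Unit Empty → ℝ) ℂ),
    cmBlockRepAt (L : Type) e₁ (frameD V) (frameD_real V) (frameD_ne V) (lineVec (L : Type) (dW c.D 0)) (fun _ => dW_real c.D 0)
        (fun _ => dW_ne c.D 0) hGR₀ ι₁ (cmPlace (L : Type) ι₁) (blockPosEquiv V) (blockNegEquiv V) eR₀' eS₀'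
        (cmBlockSectionAt (L : Type) (frameD V) (frameD_real V) (frameD_ne V) (lineVec (L : Type) (dW c.D 0)) (fun _ => dW_real c.D 0)
          (fun _ => dW_ne c.D 0) ι₁ (cmPlace (L : Type) ι₁) (blockPosEquiv V) (blockNegEquiv V) eR₀' eS₀' (κ _ _ _ _ kk)) (tensorPi Φ Φ₂) =
      tensorPi (κOp _ _ ev₀' kk Φ) Φ₂)
  (hχ₀' : ∀ u : stabilizer U21 x₀,
    ((lineScalar_zero V c.D hGR hGR₀ hGR₁ (eta₀ V c.D η) (u : U21) : ℂˣ) : ℂ) *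
        ((matA (stabilizerEquivK21.symm u)).det ^ ev₀'.eP * sclD (stabilizerEquivK21.symm u) ^ ev₀'.eQ) =
      star (sclD (stabilizerEquivK21.symm u)))

variable
  (eR₁' : PosIdx (cmXW (L : Type) (frameD V) (lineVec (L : Type) (dW c.D 1)) (fun _ => dW_real c.D 1) ι₁ (cmPlace (L : Type) ι₁)) ≃ Unit)
  (eS₁' : NegIdx (cmXW (L : Type) (frameD V) (lineVec (L : Type) (dW c.D 1)) (fun _ => dW_real c.D 1) ι₁ (cmPlace (L : Type) ι₁)) ≃ Empty)
  (ℓ₀₁' : Module.Dual ℂ (Fin 2 → ℂ))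
  (arch₀₁' : blockFamilyOfAt (L : Type) e₁ (frameD V) (frameD_real V) (frameD_ne V) (lineVec (L : Type) (dW c.D 1))
      (fun _ => dW_real c.D 1) (fun _ => dW_ne c.D 1) ι₁ (blockPosEquiv V) (blockNegEquiv V) eR₁' eS₁' (degOnePDual Empty) Φ₂ ℓ₀₁' =
    (A 1).Φinf)
  (harch₁' : ∀ a : UnitaryGroup.arch (↥(maximalRealSubfield L)) L (IsCMField.complexConj L) 3 V.Hm,
    UnitaryGroup.archAt (↥(maximalRealSubfield L)) L (IsCMField.complexConj L) 3 V.Hm (UnitaryGroup.cmPlace (L : Type) ι₁)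
        (NumberField.complexConj_smul_infinitePlace (L : Type) _) (IsCMField.complexConj_ne_one (L : Type)) a = 1 →
    ∀ ℓ, ((archSideOf V c hGR hGR₀ hGR₁ hGR₂ hGR₃ η hη hηc h₁W A).P 1).ω
        (HodgeCM.Adelic.regimeEquiv L V.Hm hV
          (UnitaryGroup.archToAdelic (↥(maximalRealSubfield L)) L (IsCMField.complexConj L) 3 V.Hm a), 1)
        (testFun (↥(maximalRealSubfield L)) (Fin 3)
          (blockFamilyOfAt (L : Type) e₁ (frameD V) (frameD_real V) (frameD_ne V) (lineVec (L : Type) (dW c.D 1))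
            (fun _ => dW_real c.D 1) (fun _ => dW_ne c.D 1) ι₁ (blockPosEquiv V) (blockNegEquiv V) eR₁' eS₁' (degOnePDual Empty) Φ₂ ℓ)
          (A 1).x₀ N) =
      testFun (↥(maximalRealSubfield L)) (Fin 3)
        (blockFamilyOfAt (L : Type) e₁ (frameD V) (frameD_real V) (frameD_ne V) (lineVec (L : Type) (dW c.D 1))
          (fun _ => dW_real c.D 1) (fun _ => dW_ne c.D 1) ι₁ (blockPosEquiv V) (blockNegEquiv V) eR₁' eS₁' (degOnePDual Empty) Φ₂ ℓ) (A 1).x₀ N)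
  (hfin₁' : ∀ kf : UnitaryGroup.finAdelic (↥(maximalRealSubfield L)) L (IsCMField.complexConj L) 3 V.Hm, kf ∈ Γ₀.K →
    ∀ Φinf : 𝓢((Fin 3 → mixedSpace (↥(maximalRealSubfield L))), ℂ),
      ((archSideOf V c hGR hGR₀ hGR₁ hGR₂ hGR₃ η hη hηc h₁W A).P 1).ω
          (HodgeCM.Adelic.regimeEquiv L V.Hm hV
            (UnitaryGroup.finAdelicToAdelic (↥(maximalRealSubfield L)) L (IsCMField.complexConj L) 3 V.Hm kf), 1)
          (testFun (↥(maximalRealSubfield L)) (Fin 3) Φinf (A 1).x₀ N) =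
        testFun (↥(maximalRealSubfield L)) (Fin 3) Φinf (A 1).x₀ N)
  (hsec₁' : ∀ u : stabilizer U21 x₀,
    cmBlockSectionAt (L : Type) (frameD V) (frameD_real V) (frameD_ne V) (lineVec (L : Type) (dW c.D 1)) (fun _ => dW_real c.D 1)
        (fun _ => dW_ne c.D 1) ι₁ (cmPlace (L : Type) ι₁) (blockPosEquiv V) (blockNegEquiv V) eR₁' eS₁' (u21FrameEquiv (u : U21), 1) =
      (archSectionFrameOf V u, 1))
  {ev₁' : VacExponents}
  (hK₁' : ∀ (kk : DPK (Fin 2) Unit Unit Empty) (Φ : SchwartzMap (DPIdx (Fin 2) Unit Unit Empty → ℝ) ℂ),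
    cmBlockRepAt (L : Type) e₁ (frameD V) (frameD_real V) (frameD_ne V) (lineVec (L : Type) (dW c.D 1)) (fun _ => dW_real c.D 1)
        (fun _ => dW_ne c.D 1) hGR₁ ι₁ (cmPlace (L : Type) ι₁) (blockPosEquiv V) (blockNegEquiv V) eR₁' eS₁'
        (cmBlockSectionAt (L : Type) (frameD V) (frameD_real V) (frameD_ne V) (lineVec (L : Type) (dW c.D 1)) (fun _ => dW_real c.D 1)
          (fun _ => dW_ne c.D 1) ι₁ (cmPlace (L : Type) ι₁) (blockPosEquiv V) (blockNegEquiv V) eR₁' eS₁' (κ _ _ _ _ kk)) (tensorPi Φ Φ₂) =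
      tensorPi (κOp _ _ ev₁' kk Φ) Φ₂)
  (hχ₁' : ∀ u : stabilizer U21 x₀,
    ((lineScalar_one V c.D hGR hGR₀ hGR₁ (eta₁ V c.D η) (u : U21) : ℂˣ) : ℂ) *
        ((matA (stabilizerEquivK21.symm u)).det ^ ev₁'.eP * sclD (stabilizerEquivK21.symm u) ^ ev₁'.eQ) =
      star (sclD (stabilizerEquivK21.symm u)))


/-- **E's `C` at the honest S term in the literal slot, `k`-dispatched** (decidable split on `k = 0`, cast on the index). -/
def archKTypeOfSlot (k : Fin 4) (hk : k = 0 ∨ k = 1) :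
    ArchKTypeData (thetaSpaceInputIn hHD hI h₁ h₃ (archSideOf V c hGR hGR₀ hGR₁ hGR₂ hGR₃ η hη hηc h₁W A) hV) k N :=
  if h0 : k = 0 then
    h0.symm ▸ archKTypeOfSlotZero hHD hI h₁ h₃ V c hGR hGR₀ hGR₁ hGR₂ hGR₃ η hη hηc h₁W A hV N Γ₀ hlevel Φ₂ eR₀' eS₀' ℓ₀₀' arch₀₀' harch₀' hfin₀' hsec₀' hK₀' hχ₀'
  else
    (hk.resolve_left h0).symm ▸ archKTypeOfSlotOne hHD hI h₁ h₃ V c hGR hGR₀ hGR₁ hGR₂ hGR₃ η hη hηc h₁W A hV N Γ₀ hlevel Φ₂ eR₁' eS₁' ℓ₀₁' arch₀₁' harch₁' hfin₁' hsec₁' hK₁' hχ₁'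

set_option backward.isDefEq.respectTransparency false in
/-- **ROW 14 for the dispatched slot term — no hypothesis beyond the two lines' inputs.** -/
theorem isWeaklyPDiff_archKTypeOfSlot (k : Fin 4) (hk : k = 0 ∨ k = 1) :
    (archKTypeOfSlot hHD hI h₁ h₃ V c hGR hGR₀ hGR₁ hGR₂ hGR₃ η hη hηc h₁W A hV N Γ₀ hlevel Φ₂ eR₀' eS₀' ℓ₀₀' arch₀₀' harch₀' hfin₀' hsec₀' hK₀' hχ₀' eR₁' eS₁' ℓ₀₁' arch₀₁' harch₁' hfin₁' hsec₁' hK₁' hχ₁' k hk).IsWeaklyPDiff BallForms.expP := by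
  unfold archKTypeOfSlot
  split
  · next h0 =>
    subst h0
    exact isWeaklyPDiff_archKTypeOfSlotZero hHD hI h₁ h₃ V c hGR hGR₀ hGR₁ hGR₂ hGR₃ η hη hηc h₁W A hV N Γ₀ hlevel Φ₂ eR₀' eS₀' ℓ₀₀' arch₀₀' harch₀' hfin₀' hsec₀' hK₀' hχ₀'
  · next h0 =>
    obtain rfl : k = 1 := hk.resolve_left h0
    exact isWeaklyPDiff_archKTypeOfSlotOne hHD hI h₁ h₃ V c hGR hGR₀ hGR₁ hGR₂ hGR₃ η hη hηc h₁W A hV N Γ₀ hlevel Φ₂ eR₁' eS₁' ℓ₀₁' arch₀₁' harch₁' hfin₁' hsec₁' hK₁' hχ₁'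

end Dispatch

end Slot

end HodgeCM.Model

end
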